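/-
Copyright: seat `ym-line-cbag-p2` (prover-ym-line-cbag-p2-g0-0), route `ColdBoxAllGroups`, crux `BulkAllGroups`
(stmt-QuantumFields-22255), line `dlr-chessboard-G` (skeleton `Cruxes/BulkAllGroups/Lines/birth.lean`).
-/
import Summits.QuantumFields.YangMills.Theorems.ColdBoxAllGroupsBulkAllGroupsKernelGoodEventG
import Summits.QuantumFields.YangMills.Theorems.ColdBoxAllGroupsBulkAllGroupsShiftedCovD
import Summits.QuantumFields.YangMills.Theorems.ColdBoxAllGroupsBulkAllGroupsDlrPlumbingG
import Summits.QuantumFields.YangMills.Theorems.WeakCouplingRatesBulkDominatesColdBoxWKernelCovCore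

/-!
# Crux `BulkAllGroups` (stmt-QuantumFields-22255), stub `stub_kernelCovExpansionG`: the A-cov CORE for every compact gauge group
# (`D` colours, two observable bounds) — G-port of `…BulkDominatesColdBoxWKernelCovCore` (`abs_kernelCov_sub_gaussian_le_core₂`)

`abs_kernelCovG_sub_gaussian_le_core₂`: for the box kernel `γ(·|ω) = boxKernelG ρ β H ω` of a compact `G` (continuous `ρ`), a likely YM event `E`,
a `D`-colour Gaussian space `D1'^{⊗D}` with a likely event `S`, a bounded tilt `W` on `S`, a measurable chart map `cfg`, the REPRESENTATION
hypotheses for the three observables `βc_x`, `βc_y`, `βc_x·βc_y` (to be produced by the one-scale representation files of the line), and quadratic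
surrogates `Q₁ = ½Σ_c(F_c + X_c(p'))²`, `Q₂ = ½Σ_c(G_c + X_c(q'))²` (`|βc∘cfg − Q| ≤ τ` on `S`):

  `|β²·Cov_{γ(·|ω)}(c_x, c_y) − ((D/2)·C² + (Σ_c F_c G_c)·C)| ≤ 6M₀²·pY + 3M²(e^{2w} − 1) + 6M²p + 2τ(M + K) + √p(2MK + K' + K²)`,

`C = boxDirProjKernel H p' q'`.  Ingredients: YM conditioning `abs_cov_sub_cov_cond_le`; R6 `abs_cov_tilted_cond_sub_cov_le` (`…ColdBoxCovBookkeeping`,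
group-free); the exact `D`-colour Gaussian covariance `cov_quadObs_piD_eq` (`…BulkAllGroupsShiftedCovD`).  The YM-side rarity uniformly over crude-good
data is `abs_boxKernelG_cov_sub_cond_le` (`…KernelGoodEventG`).  No new definition; standard axioms.  NOT a claim about the mass gap; the
Yang–Mills mass gap is NOT proved by any of this.
-/

set_option autoImplicit false

noncomputable section

open MeasureTheory ProbabilityTheory Finset
open Literature.Probability.LatticeModels Literature.MathematicalPhysics.QuantumLattice
open Literature.MathematicalPhysics.QuantumFieldTheory
open Summit.QuantumFields.YangMills.Theorems.WeakCouplingRates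

namespace Summit.QuantumFields.YangMills.Theorems.ColdBoxAllGroups

variable {N : ℕ} {G : Type*} [Group G] [TopologicalSpace G] [IsTopologicalGroup G] [CompactSpace G]
  [MeasurableSpace G] [BorelSpace G] [SecondCountableTopology G]
variable (ρ : G →* Matrix (Fin N) (Fin N) ℂ) (hρc : Continuous ρ)
include hρc

/-- **A-cov core, two constants, any compact `G`, `D` colours.**  See the module docstring. [folklore] -/
theorem abs_kernelCovG_sub_gaussian_le_core₂ {H D : ℕ} {β : ℝ} (ω : LGConfig 4 G)
    (x y : Site 4) (i j k l : Fin 4)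
    -- YM side: the good event of configurations
    {E : Set (LGConfig 4 G)} (hE : MeasurableSet E) (hE0 : boxKernelG ρ β H ω E ≠ 0)
    {pY : ℝ} (hpY : (boxKernelG ρ β H ω).real Eᶜ ≤ pY)
    {M₀ M : ℝ} (hM : 0 ≤ M) (hfM : ∀ U, |β * plaqCostAt ρ x i j U| ≤ M₀)
    (hgM : ∀ U, |β * plaqCostAt ρ y k l U| ≤ M₀)
    -- Gaussian side: chart map, small-field event, tilt
    (cfg : (Fin D → EuclideanSpace ℝ (DirFree H)) → LGConfig 4 G) (hcfg : Measurable cfg)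
    {S : Set (Fin D → EuclideanSpace ℝ (DirFree H))} (hS : MeasurableSet S) (hS0 : (Measure.pi fun _ : Fin D => boxDirichlet H) S ≠ 0)
    {p : ℝ} (hp : (Measure.pi fun _ : Fin D => boxDirichlet H).real Sᶜ ≤ p)
    {W : (Fin D → EuclideanSpace ℝ (DirFree H)) → ℝ} (hWm : Measurable W) {w : ℝ} (hW : ∀ t, |S.indicator W t| ≤ w)
    -- the representation (trunk) for the three observables
    (hRepF : ∫ U, β * plaqCostAt ρ x i j U ∂((boxKernelG ρ β H ω)[|E]) =
      ∫ t, β * plaqCostAt ρ x i j (cfg t)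
        ∂(((Measure.pi fun _ : Fin D => boxDirichlet H)[|S]).tilted (S.indicator W)))
    (hRepG : ∫ U, β * plaqCostAt ρ y k l U ∂((boxKernelG ρ β H ω)[|E]) =
      ∫ t, β * plaqCostAt ρ y k l (cfg t)
        ∂(((Measure.pi fun _ : Fin D => boxDirichlet H)[|S]).tilted (S.indicator W)))
    (hRepFG : ∫ U, β * plaqCostAt ρ x i j U * (β * plaqCostAt ρ y k l U)
        ∂((boxKernelG ρ β H ω)[|E]) =
      ∫ t, β * plaqCostAt ρ x i j (cfg t) * (β * plaqCostAt ρ y k l (cfg t))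
        ∂(((Measure.pi fun _ : Fin D => boxDirichlet H)[|S]).tilted (S.indicator W)))
    -- the surrogates (chart) on `S` and their moments
    (F G' : Fin D → ℝ) (p' q' : Plaq 4) {τ K K' : ℝ} (hτ : 0 ≤ τ) (hK : 0 ≤ K) (hK' : 0 ≤ K')
    (hFS : ∀ t ∈ S, 0 ≤ β * plaqCostAt ρ x i j (cfg t) ∧ β * plaqCostAt ρ x i j (cfg t) ≤ M)
    (hGS : ∀ t ∈ S, 0 ≤ β * plaqCostAt ρ y k l (cfg t) ∧ β * plaqCostAt ρ y k l (cfg t) ≤ M)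
    (hSurF : ∀ t ∈ S, |β * plaqCostAt ρ x i j (cfg t) - (1 / 2 : ℝ) * ∑ c, (F c + dirCirc H p' (t c)) ^ 2| ≤ τ)
    (hSurG : ∀ t ∈ S, |β * plaqCostAt ρ y k l (cfg t) - (1 / 2 : ℝ) * ∑ c, (G' c + dirCirc H q' (t c)) ^ 2| ≤ τ)
    (hQ₁₂ : MemLp (fun t : Fin D → EuclideanSpace ℝ (DirFree H) =>
      ((1 / 2 : ℝ) * ∑ c, (F c + dirCirc H p' (t c)) ^ 2) * ((1 / 2 : ℝ) * ∑ c, (G' c + dirCirc H q' (t c)) ^ 2)) 2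
      (Measure.pi fun _ : Fin D => boxDirichlet H))
    (hK₁ : ∫ t, ((1 / 2 : ℝ) * ∑ c, (F c + dirCirc H p' (t c)) ^ 2) ^ 2 ∂(Measure.pi fun _ : Fin D => boxDirichlet H) ≤ K ^ 2)
    (hK₂ : ∫ t, ((1 / 2 : ℝ) * ∑ c, (G' c + dirCirc H q' (t c)) ^ 2) ^ 2 ∂(Measure.pi fun _ : Fin D => boxDirichlet H) ≤ K ^ 2)
    (hK₁₂ : ∫ t, (((1 / 2 : ℝ) * ∑ c, (F c + dirCirc H p' (t c)) ^ 2) * ((1 / 2 : ℝ) * ∑ c, (G' c + dirCirc H q' (t c)) ^ 2)) ^ 2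
      ∂(Measure.pi fun _ : Fin D => boxDirichlet H) ≤ K' ^ 2) :
    |β ^ 2 * ((∫ U, plaqCostAt ρ x i j U * plaqCostAt ρ y k l U ∂(boxKernelG ρ β H ω)) -
          (∫ U, plaqCostAt ρ x i j U ∂(boxKernelG ρ β H ω)) *
            (∫ U, plaqCostAt ρ y k l U ∂(boxKernelG ρ β H ω))) -
        ((D : ℝ) / 2 * boxDirProjKernel H p' q' ^ 2 + (∑ c, F c * G' c) * boxDirProjKernel H p' q')| ≤
      6 * M₀ * M₀ * pY + (3 * M ^ 2 * (Real.exp (2 * w) - 1) + 6 * M ^ 2 * p + 2 * τ * (M + K) +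
        Real.sqrt p * (2 * M * K + K' + K ^ 2)) := by
  haveI : IsProbabilityMeasure (boxKernelG ρ β H ω) := isProbabilityMeasure_boxKernelG ρ hρc β H ω
  set μ := boxKernelG ρ β H ω with hμ
  set γ : Measure (Fin D → EuclideanSpace ℝ (DirFree H)) := Measure.pi fun _ : Fin D => boxDirichlet H with hγ
  set f : LGConfig 4 G → ℝ := fun U => β * plaqCostAt ρ x i j U with hf
  set g : LGConfig 4 G → ℝ := fun U => β * plaqCostAt ρ y k l U with hg
  set Q₁ : (Fin D → EuclideanSpace ℝ (DirFree H)) → ℝ := fun t => (1 / 2 : ℝ) * ∑ c, (F c + dirCirc H p' (t c)) ^ 2 with hQ₁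
  set Q₂ : (Fin D → EuclideanSpace ℝ (DirFree H)) → ℝ := fun t => (1 / 2 : ℝ) * ∑ c, (G' c + dirCirc H q' (t c)) ^ 2 with hQ₂
  have hfm : Measurable f := measurable_const.mul (measurable_plaqCostAtG ρ hρc x i j)
  have hgm : Measurable g := measurable_const.mul (measurable_plaqCostAtG ρ hρc y k l)
  have hfi : Integrable f μ := integrable_of_abs_le hfm.aestronglyMeasurable hfM
  have hgi : Integrable g μ := integrable_of_abs_le hgm.aestronglyMeasurable hgM
  have hfgi : Integrable (fun U => f U * g U) μ :=
    hgi.bdd_mul hfm.aestronglyMeasurable (ae_of_all _ fun U => by rw [Real.norm_eq_abs]; exact hfM U)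
  -- (0) `β²·Cov(c_x, c_y) = Cov(βc_x, βc_y)`
  have e0 : β ^ 2 * ((∫ U, plaqCostAt ρ x i j U * plaqCostAt ρ y k l U ∂μ) -
        (∫ U, plaqCostAt ρ x i j U ∂μ) * (∫ U, plaqCostAt ρ y k l U ∂μ)) =
      (∫ U, f U * g U ∂μ) - (∫ U, f U ∂μ) * (∫ U, g U ∂μ) := by
    have e1 : ∫ U, f U * g U ∂μ = β ^ 2 * ∫ U, plaqCostAt ρ x i j U * plaqCostAt ρ y k l U ∂μ := by
      rw [← integral_const_mul]; refine integral_congr_ae (ae_of_all _ fun U => ?_); simp only [hf, hg]; ring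
    rw [e1, hf, hg, integral_const_mul, integral_const_mul]; ring
  -- (1) YM conditioning
  have h1 : |((∫ U, f U * g U ∂μ) - (∫ U, f U ∂μ) * (∫ U, g U ∂μ)) -
      ((∫ U, f U * g U ∂(μ[|E])) - (∫ U, f U ∂(μ[|E])) * (∫ U, g U ∂(μ[|E])))| ≤ 6 * M₀ * M₀ * pY := by
    have key := abs_cov_sub_cov_cond_le (μ := μ) hE hE0 hfi hgi hfgi hfM hgM
    have h6 : 0 ≤ 6 * M₀ * M₀ := by nlinarith [sq_nonneg M₀]
    exact key.trans (mul_le_mul_of_nonneg_left hpY h6)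
  -- (2)+(3) representation and covariance bookkeeping on the Gaussian side
  have hQ₁m : MemLp Q₁ 2 γ := memLp_two_quadObs_piD F p'
  have hQ₂m : MemLp Q₂ 2 γ := memLp_two_quadObs_piD G' q'
  have hFm : Measurable fun t => f (cfg t) := hfm.comp hcfg
  have hGm : Measurable fun t => g (cfg t) := hgm.comp hcfg
  have h3 := abs_cov_tilted_cond_sub_cov_le (γ := γ) hS hS0 hWm hW (F := fun t => f (cfg t)) (G := fun t => g (cfg t))
    (Q₁ := Q₁) (Q₂ := Q₂) hFm hGm hQ₁m hQ₂m hQ₁₂ hM hτ hK hK' hFS hGS hSurF hSurG hp hK₁ hK₂ hK₁₂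
  -- (4) the exact Gaussian covariance
  have h4 : (∫ t, Q₁ t * Q₂ t ∂γ) - (∫ t, Q₁ t ∂γ) * (∫ t, Q₂ t ∂γ) =
      (D : ℝ) / 2 * boxDirProjKernel H p' q' ^ 2 + (∑ c, F c * G' c) * boxDirProjKernel H p' q' := cov_quadObs_piD_eq F G' p' q'
  -- assemble
  rw [e0, ← h4]
  have hrepF' : ∫ U, f U ∂(μ[|E]) = ∫ t, f (cfg t) ∂((γ[|S]).tilted (S.indicator W)) := hRepF
  have hrepG' : ∫ U, g U ∂(μ[|E]) = ∫ t, g (cfg t) ∂((γ[|S]).tilted (S.indicator W)) := hRepG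
  have hrepFG' : ∫ U, f U * g U ∂(μ[|E]) = ∫ t, f (cfg t) * g (cfg t) ∂((γ[|S]).tilted (S.indicator W)) := hRepFG
  rw [hrepF', hrepG', hrepFG'] at h1
  calc |((∫ U, f U * g U ∂μ) - (∫ U, f U ∂μ) * (∫ U, g U ∂μ)) - ((∫ t, Q₁ t * Q₂ t ∂γ) - (∫ t, Q₁ t ∂γ) * (∫ t, Q₂ t ∂γ))|
      ≤ |((∫ U, f U * g U ∂μ) - (∫ U, f U ∂μ) * (∫ U, g U ∂μ)) -
            ((∫ t, f (cfg t) * g (cfg t) ∂((γ[|S]).tilted (S.indicator W))) -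
              (∫ t, f (cfg t) ∂((γ[|S]).tilted (S.indicator W))) * (∫ t, g (cfg t) ∂((γ[|S]).tilted (S.indicator W))))| +
          |((∫ t, f (cfg t) * g (cfg t) ∂((γ[|S]).tilted (S.indicator W))) -
              (∫ t, f (cfg t) ∂((γ[|S]).tilted (S.indicator W))) * (∫ t, g (cfg t) ∂((γ[|S]).tilted (S.indicator W)))) -
            ((∫ t, Q₁ t * Q₂ t ∂γ) - (∫ t, Q₁ t ∂γ) * (∫ t, Q₂ t ∂γ))| := abs_sub_le _ _ _
    _ ≤ 6 * M₀ * M₀ * pY + (3 * M ^ 2 * (Real.exp (2 * w) - 1) + 6 * M ^ 2 * p + 2 * τ * (M + K) +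
        Real.sqrt p * (2 * M * K + K' + K ^ 2)) := add_le_add h1 h3

end Summit.QuantumFields.YangMills.Theorems.ColdBoxAllGroups

end
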